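import Summits.QuantumFields.YangMills.Theorems.BalabanUVNodesK2NamedJetsRunRemAt
import Summits.QuantumFields.YangMills.Theorems.BalabanUVNodesK1EndOfNodes13PWSOfPartialSums
import Summits.QuantumFields.YangMills.Theorems.BalabanUVNodesK1WindowExactCriterion

/-!
# BalabanUVNodes ∕ K1⁷ — THE K1-SIDE READER OF K2⁷'s RUN EDITION: `StabilityBAtRecordR13SepCoPH`'s consequent AT θ, and the route decl BY NAME, from a rung-1 datum
# and the RUN letter `RunRemAt F κ θ h c` (ym-nodeO DEF-1, `BalabanUVNodesK2NamedJetsRunRemAt`, p596574) + the bare drift + ONE numeric ceiling match — NO box letter on the K1 road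

TRACK A (YM-PLAN §2d), node N24 (binder B2, COMPOSITE), WIDTH SEAT `pub-ymgap-dag-n24-w1` (gen 2; director-ym №197 ∕ HUMAN RULING D-0149).  Key of record: K1⁷
`StabilityBAtRecordR13SepCoPH` = stmt-QuantumFields-20542; this file `--supports` it AS A HELPER (count-neutral).  Seventh module of the seat's lineage (g0: p584070 · p586375 ·
p588006 · p588994 · p591432 · p595293).  The LOCATED point it answers is DEF-1's (p596574 header, pub-ymgap INBOX l.27118 cc dag-n24): «for a K1-side reader: run data give run-wise
(PS) and per-level survivor bounds only — NO box ceiling `BetaUpperH` and NO box floor are recoverable from the run edition».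

WHY NOW (plan g82 `D82-K2V5/DECISION-204.md`, director-ym №204).  K2⁷'s skeleton v5 re-keys EVERY K2⁷ stub on the crux's full prefix — each now ASSUMES
`B16.EndStatementBPrinted (datumOfRecord₁₃SepCoPH F 2 θ hP).C` and the window.  So the g0 road «K1⁷ = stub 1 + K2⁷'s two stubs + the ceiling match» (p595293 §2∕§3, keyed on v4's
(B)-free texts) has no registered supplier any more: on the K1 side the β-rows must sit at K1⁷'s OWN witness (DECISION-204 F3: «the print-faithful home of every regime-dependent
estimate is the ∃-side»).  This file types that ∃-side closing shape IN THE RUN CURRENCY — the weaker of the two letters of record (`runRemAt_of_remAt`) — and shows the K1 road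
needs nothing box-wise.

THE POINT.  The END road of record is ALREADY run-wise: g0's `K1EndOfNodes13PWSOfPartialSums.endStatementBPrinted_of_nodesP_alongRuns_partialSums` (p588006 §2) reads the ceiling
`β_{j+1}(g_j) ≤ w.βup` and the partial-sum floor `Σ_{j∈[m,n)} β_{j+1}(g_j) ≥ −M` ONLY AT THE POINTS `g_j` of the in-window runs of the world's construction, which satisfy (0.20)
(the guarded leaf at an S-class record, dag-n10-d's `rgFlow_of_smallCouplings_of_isRecordOfRecord₁₃CSepCoPHS`).  Under the dictionary `CurriesHBeta` those points are the prefixes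
of an `RGEqH`-solution staying in `]0, γ₀]` (`DagBinding.rgEqH_of_curries`) — EXACTLY the sequences DEF-1's `RunConstRemainder β b r γ₀` quantifies over.  Hence, from the run
letter at scale `c` and the drift of the named numbers (`OneLoopDrift (stepBal 2 F.L) A (beta0OfJs F κ)`, rescaled by `oneLoopDrift_const_mul`): the run-wise CEILING
`β_{j+1}(g_j) ≤ c·b_j + s ≤ c·stepBal 2 F.L + 2|c|A + s ≤ 2c·stepBal 2 F.L + 2|c|A` (band `band_of_drift`, cap `s ≤ c·stepBal 2 F.L`) and the run-wise (PS) `≥ −2|c|A`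
(DEF-1's `runwisePS_of_drift_runConstRemainder`); the one K1-side letter left is the numeric MATCH `2c·stepBal 2 F.L + 2|c|A ≤ w.βup` against the rung-1 world's ceiling (N11's
`flowControl` reads `w.βup` — dag-n12-d ANSWER-CEILING, INBOX l.25740).  OFF the runs the run letter still bounds the FIRST β-function on `]0, γ₀]` (a one-point history is an
(0.20)-run up to `0`), which is dag-n13-w4's weakest window input (`K1WindowExactCriterion.window_of_frequently_beta_le`) — so the non-vacuity window comes for free, too.  The
survivor-continuity conjunct `SurvCont` and the anchor of `RunRemAt` are UNREAD by K1 (they serve K2⁷'s endpoint).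

WHAT IS HERE (theorems only; 0 `def`, 0 `sorry`, standard axioms):
* §1 generic (any `β : HBeta`, any construction currying it): `rgEqH_mono` · `stepInInterval_of_flowInInterval` · `upper_alongRun_of_runConstRemainder` (run letter + `∀ k, b_k ≤ B` ⇒
  run-wise ceiling `B + r` along in-window (0.20)-runs) · `partialSums_alongRun_of_runwisePS` (DEF-1's (PS) shape ⇒ the END road's run-wise floor) · `betaZero_le_of_runConstRemainder`
  · `frequently_betaZero_le_of_runConstRemainder` (level `0` ⇒ the frequent upper bound at `0⁺`).
* §2 ★ `endStatementBPrinted_window_of_isRecordOfRecord₁₃CSepCoPHS_of_nodes_of_runLetters` (general `N`, D-KEYED at any S-class record `(D, w)`: nodes + `RunConstRemainder D.βfun b r γ₀`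
  + `∀ k, b_k ≤ B` + `B + r ≤ w.βup` + run-wise (PS) `−M` ⊢ `EndStatementBPrinted D.C` ∧ the `K ≥ 1` window; window letter shrunk to `min (min w.γ γ₀) √(c₀∕(M+1))`,
  `c₀ := 1 − (1+w.β₀)⁻²`, as in p588006 §4) · ★ `stabilityB_body_of_rung1At_of_runLetters` (θ-keyed: the crux's consequent AT θ from a rung-1 datum, plan's `RecordS` spelled out).
* §3 ★★ `stabilityB_body_of_rung1At_of_runRemAt_of_drift` (`N = 2`): rung-1 datum + `RunRemAt F κ θ h c` + `OneLoopDrift (stepBal 2 F.L) A (beta0OfJs F κ)` +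
  `2·(c·stepBal 2 F.L) + 2·(|c|·A) ≤ w.βup` ⊢ the consequent AT θ · `stabilityB_body_of_rung1At_of_remAt_of_drift_of_match` (the box letter `RemAt` ⟹ the run letter; = g0's E3 §1
  with its box-ceiling letter `hhi` traded for the numeric match).
* §4 ★★★ `stabilityBAtRecordR13SepCoPH_of_rung1WithRunRowsAt` — THE ROUTE DECL BY NAME from ONE ∃-side producer «rung 1 WITH run rows at the witness»:
  `∀ F, Inhabited13-body F → ∃ θ h, unity ∧ slots ∧ Admissible ∧ ∃ κ c A, RunRemAt F κ θ h c ∧ OneLoopDrift (stepBal 2 F.L) A (beta0OfJs F κ) ∧ ∃ w, 2c·stepBal + 2|c|A ≤ w.βup ∧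
  RecordS-body ∧ ∀ P, Nodes (leavesP w P)` (the post-№204 K1 closing shape in the run currency) · ★★★ `stabilityBAtRecordR13SepCoPH_of_stub1_of_runRowsMatch_at_witness` — the same from the
  REGISTERED stub-1 text (v5 VERBATIM, `RecordS` unfolded) + «run rows + drift + match at every rung-1 witness» · `stabilityBAtRecordR13SepCoPH_of_rung1WithBoxRowsAt` (the same producer
  in ed.3's BOX currency `RemAt` — g0's E3 currency — is a special case: a K1 v6 cut may register either letter at the witness; the run one is the weaker ask).

v1.1 (DOCFIX, 2026-08-28; declarations byte-identical).  LOCATED (A6) — refuter CRIT-1's kernel-certified negative control K1NEGCTL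
(`Theorems/StabilityBAtRecordR13SepCoPH/Negative/`, p602267; pub-ymgap INBOX l.28120): the thirteen DAG nodes are ANTITONE in the world's ceiling `w.βup` (a SMALLER ceiling keeps the
nodes — g0's `K1BetaWindow13SOfNodes13PWSOfBoxH.nodes_leavesP_reletter_ceiling_of_le`), so ONE rung-1 witness yields rung-1 witnesses with arbitrarily negative `w.βup`; hence ANY letter
quantified over ALL rung-1 witnesses and ending in `… ≤ w.βup` is INCONSISTENT with stub 1 on every inhabited family.  This applies to §4's SECOND theorem
`stabilityBAtRecordR13SepCoPH_of_stub1_of_runRowsMatch_at_witness` (its `hrows` is such a letter: `2c·stepBal 2 F.L + 2|c|A ≤ w.βup` at EVERY witness, and a negative `c` cannot rescue it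
since `RunConstRemainder … s γ₀` forces `0 ≤ s ≤ c·stepBal 2 F.L`): the theorem is TRUE and VACUOUS-BY-ANTECEDENT — do NOT cite it as a closing road.  The LIVE roads are the ∃-BUNDLED
producer `stabilityBAtRecordR13SepCoPH_of_rung1WithRunRowsAt` (§4 first; the world chosen WITH the rows in hand), its box twin `…BoxRowsAt`, the θ-keyed §2–§3, and — since plan g82
registered K1⁷ v6 (03f66ac9cc89391f, 03:16:54Z) — the skeleton's own `StabilityBAtRecordR13SepCoPH_ofRunRows` ∕ the tree mirror `K1V6Defs.stabilityBAtRecordR13SepCoPH_of_stubTexts`, all of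
which key the world AFTER the rows.  (The same status holds for g0's ∀-witness concluders `…OfSignBoxH` :246, `…OfPartialSums` §5, `…OfK2NamedJetsE3` §3.)

HONEST SCOPE ∕ A6.  Implications only; rung 1, the run rows ((P6) — the VALUE of κ — unpinned; scale `c` free), the drift and the match are DISPLAYED hypotheses inhabited at NO θ
here («not exhibited», №167); whether a rung-1 world clears a given ceiling is the rung-1 lanes' question (N11's `h11`), NOT claimed.  Nothing of Bałaban asserted; K1⁷ ∕ K2⁷ NOT
closed; no stub closed; N24 COMPOSITE — no discharge, no count claim (typed 28∕28 · discharged 5∕27 unmoved).  One finite 𝕋⁴ programme at fixed ε, Bałaban AS PRINTED; R4 closes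
ONLY the conditional finite-𝕋⁴ rung `BalabanLadder.UV` — the YM mass gap (Clay) is NOT proved by any of this; nothing continuum ∕ ℝ⁴ ∕ OS.  Theorems only: no `def`, no
`instance`, no `sorry`, standard axioms.  References (context; nothing printed is used as a hypothesis): [I] = [Balaban1987RG1] CMP **109** (1987): (0.17)–(0.20) pp.255–256, Thm 2
p.259, (1.20)–(1.22) p.264, Thm 3 p.264, (2.12)–(2.14) p.268, (5.10) p.293; [III] = [Balaban1988Convergent] CMP **119** (1988): (2.6) p.255, Cor. 3 (2.50) p.264; [V] =
[Balaban1989LargeFieldII] CMP **122** (1989): Thm 1 + (0.1) pp.355–356, p.391.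
-/

noncomputable section

open scoped Matrix.Norms.L2Operator
open Filter Topology

namespace Summit.QuantumFields.YangMills.BalabanUVNodes.K1EndOfNodes13PWSOfRunRemAt

open Literature.MathematicalPhysics.QuantumFieldTheory.Balaban1983to89
open Literature.MathematicalPhysics.QuantumFieldTheory.Balaban1983to89.Node00
open DagBinding T4Continuum T4DatumAssembly FlowStepRuns
open FlowStep (HBeta RGEqH prefixOf prefixOf_apply BetaUpperH)
open Literature.MathematicalPhysics.QuantumFieldTheory.Balaban1983to89.Beta.Drift (OneLoopDrift)
open Summit.QuantumFields.YangMills.Theorems.BalabanUVNodesK2JsOfRecord (StepColourData beta0OfJs)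
open Summit.QuantumFields.YangMills.Theorems.BalabanUVNodesK2NamedJetsRemAt (RemAt band_of_drift)
open Summit.QuantumFields.YangMills.Theorems.BalabanUVNodesK2NamedJetsRunRemAt (RunRemAt RunConstRemainder runRemAt_of_remAt runwisePS_of_drift_runConstRemainder)
open Summit.QuantumFields.YangMills.Theorems.EndpointGivenBR13SepCoPH.Negative.RemNamedJets13FalseOfTwoNormalisations (oneLoopDrift_const_mul)
open Summit.QuantumFields.YangMills.BalabanUVNodes.K1BetaWindow13SOfNodes13PWSOfBoxH (nodes_leavesP_reletter_of_le_all isRecordOfRecord₁₃CSepCoPHS_reletter_of_le)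
open Summit.QuantumFields.YangMills.BalabanUVNodes.K1EndOfNodes13PWSOfPartialSums (endStatementBPrinted_of_nodesP_alongRuns_partialSums)
open Summit.QuantumFields.YangMills.Theorems.BalabanUVNodesK1WindowExactCriterion (window_of_frequently_beta_le)

/-! ## §1. Generic: run letters ⟹ the run-wise letters the END road reads, along the in-window (0.20)-runs of any construction currying `β` -/

section Generic

variable {β : HBeta} {b : ℕ → ℝ}

/-- (0.20) up to `K` restricts to (0.20) up to every `n ≤ K`. [cite: Balaban1987RG1, (0.20) p.256 (bookkeeping)] -/
theorem rgEqH_mono {g : ℕ → ℝ} {K n : ℕ} (h : RGEqH K β g) (hn : n ≤ K) : RGEqH n β g :=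
  fun k hk => h k (lt_of_lt_of_le hk hn)

/-- An in-interval run (`Flow.InInterval γ K`, `γ ≤ γ₀`) is a `]0, γ₀]`-sequence up to every `n ≤ K` (`Step.InInterval γ₀ n`). [cite: Balaban1987RG1, Thm 1 p.259 (bookkeeping)] -/
theorem stepInInterval_of_flowInInterval (Fl : Flow) {γ γ₀ : ℝ} {K n : ℕ} (hI : Fl.InInterval γ K) (hγ : γ ≤ γ₀) (hn : n ≤ K) :
    Step.InInterval γ₀ n Fl.g :=
  fun k hk => ⟨(hI k (hk.trans hn)).1, (hI k (hk.trans hn)).2.trans hγ⟩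

/-- **RUN LETTER ⟹ RUN-WISE CEILING.**  At a construction `C` whose run-wise β-functions curry the history family `β` (`CurriesHBeta`): DEF-1's run-wise constant remainder
`RunConstRemainder β b r γ₀` and a uniform bound `b_k ≤ B` on the reference sequence give, along every run that satisfies (0.20) and stays in `]0, γ]`, `γ ≤ γ₀`, the run-wise
ceiling `β_{j+1}(g_j) ≤ B + r`, `j < K` — the `hhi` input of the END road (p588006 §2).  The run's history IS an `RGEqH`-solution in the window (`DagBinding.rgEqH_of_curries`) and its
`β_{j+1}(g_j)` IS `β j (g_0,…,g_j)` (`DagBinding.update_prefixOf_last`). [cite: Balaban1987RG1, (0.20) p.256, §1 (1.22) p.264 and Thm 3 p.264 (bookkeeping)] -/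
theorem upper_alongRun_of_runConstRemainder (C : B12.Construction) (β : HBeta) (hcur : CurriesHBeta C β) {b : ℕ → ℝ} {r γ₀ γ B : ℝ} (hγ : γ ≤ γ₀)
    (hrem : RunConstRemainder β b r γ₀) (hB : ∀ k, b k ≤ B) (P : B12.RunParams) (hrg : (C P).flow.SatisfiesRG P.K) (hI : (C P).flow.InInterval γ P.K) :
    ∀ j, j < P.K → (C P).flow.β (j + 1) ((C P).flow.g j) ≤ B + r := by
  intro j hjK
  have hRG : RGEqH P.K β (C P).flow.g := rgEqH_of_curries C β hcur P hrg
  have hIs : Step.InInterval γ₀ P.K (C P).flow.g := stepInInterval_of_flowInInterval _ hI hγ le_rfl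
  have h1 := (abs_le.mp (hrem P.K (C P).flow.g hRG hIs j hjK.le)).2
  rw [hcur P j _ hjK, update_prefixOf_last]
  linarith [hB j]

/-- **RUN-WISE (PS) ⟹ THE END ROAD's RUN-WISE FLOOR.**  DEF-1's (PS) shape «`−M ≤ Σ_{j∈[k,n)} β j (g_0,…,g_j)` along every `RGEqH n`-solution in `]0, γ₀]`» gives, along every
run of `C` with (0.20) staying in `]0, γ]`, `γ ≤ γ₀`: `−M ≤ Σ_{j∈[m,n)} β_{j+1}(g_j)` for `m ≤ n ≤ K` — the `hps` input of the END road (p588006 §2).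
[cite: Balaban1987RG1, (0.20) p.256 and Thm 2 p.259 (first sentence) (bookkeeping)] -/
theorem partialSums_alongRun_of_runwisePS (C : B12.Construction) (β : HBeta) (hcur : CurriesHBeta C β) {M γ₀ γ : ℝ} (hγ : γ ≤ γ₀)
    (hps : ∀ (n : ℕ) (gs : ℕ → ℝ), RGEqH n β gs → Step.InInterval γ₀ n gs → ∀ k, k ≤ n → -M ≤ ∑ j ∈ Finset.Ico k n, β j (prefixOf gs j))
    (P : B12.RunParams) (hrg : (C P).flow.SatisfiesRG P.K) (hI : (C P).flow.InInterval γ P.K) :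
    ∀ m n, m ≤ n → n ≤ P.K → -M ≤ ∑ j ∈ Finset.Ico m n, (C P).flow.β (j + 1) ((C P).flow.g j) := by
  intro m n hmn hnK
  have hRG : RGEqH n β (C P).flow.g := rgEqH_mono (rgEqH_of_curries C β hcur P hrg) hnK
  have hIs : Step.InInterval γ₀ n (C P).flow.g := stepInInterval_of_flowInInterval _ hI hγ hnK
  have h := hps n (C P).flow.g hRG hIs m hmn
  have hsum : ∑ j ∈ Finset.Ico m n, (C P).flow.β (j + 1) ((C P).flow.g j) = ∑ j ∈ Finset.Ico m n, β j (prefixOf (C P).flow.g j) := by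
    refine Finset.sum_congr rfl fun j hj => ?_
    have hjK : j < P.K := lt_of_lt_of_le (Finset.mem_Ico.mp hj).2 hnK
    rw [hcur P j _ hjK, update_prefixOf_last]
  rw [hsum]
  exact h

/-- **OFF THE RUNS, THE RUN LETTER STILL BOUNDS THE FIRST β-FUNCTION**: a one-point history `(x)`, `x ∈ ]0, γ₀]`, is the prefix of the constant sequence `x`, an (0.20)-run up to `0`
(no equation to check) in `]0, γ₀]`; so `β 0 (x) ≤ b_0 + r`. [cite: Balaban1987RG1, (0.17)–(0.20) pp.255–256 and §1 p.264 (bookkeeping)] -/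
theorem betaZero_le_of_runConstRemainder {r γ₀ : ℝ} (hrem : RunConstRemainder β b r γ₀) {x : ℝ} (hx : 0 < x) (hxγ : x ≤ γ₀) :
    β 0 (fun _ => x) ≤ b 0 + r := by
  have hRG : RGEqH 0 β (fun _ => x) := fun k hk => absurd hk (Nat.not_lt_zero k)
  have hI : Step.InInterval γ₀ 0 (fun _ => x) := fun _ _ => ⟨hx, hxγ⟩
  have h := (abs_le.mp (hrem 0 (fun _ => x) hRG hI 0 le_rfl)).2
  have e : prefixOf (fun _ : ℕ => x) 0 = fun _ => x := rfl
  rw [e] at h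
  linarith

/-- … hence a FREQUENT (indeed eventual) upper bound on the first β-function at `0⁺` — dag-n13-w4's weakest located window input (`K1WindowExactCriterion` §2).
[cite: Balaban1987RG1, (0.17)–(0.20) pp.255–256 and §1 p.264 (elementary)] -/
theorem frequently_betaZero_le_of_runConstRemainder {r γ₀ : ℝ} (hγ₀ : 0 < γ₀) (hrem : RunConstRemainder β b r γ₀) :
    ∃ B : ℝ, ∃ᶠ x in 𝓝[>] (0 : ℝ), β 0 (fun _ => x) ≤ B := by
  have hlt : ∀ᶠ x in 𝓝[>] (0 : ℝ), x < γ₀ := (eventually_lt_nhds hγ₀).filter_mono nhdsWithin_le_nhds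
  have hpos : ∀ᶠ x in 𝓝[>] (0 : ℝ), 0 < x := eventually_mem_nhdsWithin
  have hev : ∀ᶠ x in 𝓝[>] (0 : ℝ), β 0 (fun _ => x) ≤ b 0 + r := by
    filter_upwards [hlt, hpos] with x hx hx0
    exact betaZero_le_of_runConstRemainder hrem hx0 hx.le
  exact ⟨b 0 + r, hev.frequently⟩

end Generic

/-! ## §2. ★ The END and the window AT AN S-CLASS RECORD from the thirteen nodes and RUN letters only (general `N`); the crux's consequent AT θ -/

section AtRecord

variable {F : T4Family} {N : ℕ} [NeZero N]

/-- **★ END + WINDOW AT ANY S-CLASS STAGE-13 RECORD `(D, w)` FROM THE NODES AND RUN LETTERS ONLY** (D-keyed).  Inputs: the thirteen DAG nodes at every run of `w`; on SOME level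
`γ₀ > 0`: DEF-1's run-wise constant remainder `RunConstRemainder D.βfun b r γ₀` relative to a reference sequence bounded by `B`, the numeric ceiling match `B + r ≤ w.βup`, and the
run-wise (PS) letter with defect `M` (DEF-1's shape).  Output: `B16.EndStatementBPrinted D.C` and the `K ≥ 1` window at `D`.  Road: `M ≥ 0` (empty sum at the one-point run `(γ₀)`);
`c₀ := 1 − (1+w.β₀)⁻² > 0`; the world's window re-lettered to `γ₁ := min (min w.γ γ₀) √(c₀∕(M+1))` (g0's re-lettering lemmas: nodes kept, S-class kept), so `M·γ₁² ≤ c₀`; guarded (0.20)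
by dag-n10-d's `rgFlow_of_smallCouplings_of_isRecordOfRecord₁₃CSepCoPHS`; run-wise letters by §1 at `D.curries`; END by p588006 §2; window by dag-n13-w4's `window_of_frequently_beta_le`
from §1's level-0 bound.  NO box letter is read.  CONDITIONAL; nothing of Bałaban asserted; K1⁷ NOT closed.
[cite: Balaban1989LargeFieldII, Thm 1 p.355 + (0.1) pp.355–356 + p.391; Balaban1988Convergent, (2.6) p.255, Cor. 3 (2.50) p.264; Balaban1987RG1, (0.17)–(0.20) pp.255–256, Thm 2 p.259, §1 (1.22) p.264, Thm 3 p.264] -/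
theorem endStatementBPrinted_window_of_isRecordOfRecord₁₃CSepCoPHS_of_nodes_of_runLetters {D : FiniteEpsData F (SU N)} {w : WorldP}
    (hRS : IsRecordOfRecord₁₃CSepCoPHS F N D w) (hnodes : ∀ P : B12.RunParams, Nodes (leavesP w P))
    {b : ℕ → ℝ} {r γ₀ B M : ℝ} (hγ₀ : 0 < γ₀) (hrem : RunConstRemainder D.βfun b r γ₀) (hB : ∀ k, b k ≤ B) (hmatch : B + r ≤ w.βup)
    (hps : ∀ (n : ℕ) (gs : ℕ → ℝ), RGEqH n D.βfun gs → Step.InInterval γ₀ n gs → ∀ k, k ≤ n → -M ≤ ∑ j ∈ Finset.Ico k n, D.βfun j (prefixOf gs j)) :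
    B16.EndStatementBPrinted D.C ∧
      ∃ γ₁ : ℝ, 0 < γ₁ ∧ ∀ γ : ℝ, 0 < γ → γ ≤ γ₁ → ∃ P : B12.RunParams, 1 ≤ P.K ∧ (D.C P).flow.InInterval γ P.K := by
  have hγw : 0 < w.γ := gamma_pos_of_isRecordOfRecord₁₃CSepCoPHS hRS
  have hC : w.C = D.C := construction_eq_of_isRecordOfRecord₁₃CSepCoPHS hRS
  -- M ≥ 0 from the empty sum along the one-point run `(γ₀)`
  have hM : 0 ≤ M := by
    have hRG : RGEqH 0 D.βfun (fun _ => γ₀) := fun k hk => absurd hk (Nat.not_lt_zero k)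
    have hI : Step.InInterval γ₀ 0 (fun _ => γ₀) := fun _ _ => ⟨hγ₀, le_rfl⟩
    have h0 := hps 0 (fun _ => γ₀) hRG hI 0 le_rfl
    simp only [Finset.Ico_self, Finset.sum_empty] at h0
    linarith
  -- the smallness constant and the shrunk window
  set c₀ : ℝ := 1 - ((1 + w.β₀) ^ 2)⁻¹ with hc₀_def
  have hc₀ : 0 < c₀ := by
    have h1 : 1 < (1 + w.β₀) ^ 2 := by nlinarith [w.β₀_pos]
    have h2 : ((1 + w.β₀) ^ 2)⁻¹ < 1 := inv_lt_one_of_one_lt₀ h1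
    rw [hc₀_def]; linarith
  set γM : ℝ := Real.sqrt (c₀ / (M + 1)) with hγM_def
  have hγM : 0 < γM := Real.sqrt_pos.mpr (by positivity)
  set γ₁ : ℝ := min (min w.γ γ₀) γM with hγ₁_def
  have hγ₁ : 0 < γ₁ := lt_min (lt_min hγw hγ₀) hγM
  have hγ₁w : γ₁ ≤ w.γ := (min_le_left _ _).trans (min_le_left _ _)
  have hγ₁₀ : γ₁ ≤ γ₀ := (min_le_left _ _).trans (min_le_right _ _)
  have hsmall : M * γ₁ ^ 2 ≤ c₀ := by
    have h1 : γ₁ ^ 2 ≤ γM ^ 2 := pow_le_pow_left₀ hγ₁.le (min_le_right _ _) 2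
    have h2 : γM ^ 2 = c₀ / (M + 1) := by rw [hγM_def, Real.sq_sqrt (by positivity)]
    have h3 : M * (c₀ / (M + 1)) ≤ c₀ := by
      rw [mul_div_assoc']
      rw [div_le_iff₀ (by positivity)]
      nlinarith [hc₀, hM]
    calc M * γ₁ ^ 2 ≤ M * γM ^ 2 := mul_le_mul_of_nonneg_left h1 hM
      _ = M * (c₀ / (M + 1)) := by rw [h2]
      _ ≤ c₀ := h3
  -- the re-lettered world and the END along runs
  have hRS' : IsRecordOfRecord₁₃CSepCoPHS F N D { w with γ := γ₁, b := w.b, b_pos := w.b_pos } :=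
    isRecordOfRecord₁₃CSepCoPHS_reletter_of_le hRS hγ₁ hγ₁w w.b_pos
  have hB : B16.EndStatementBPrinted ({ w with γ := γ₁, b := w.b, b_pos := w.b_pos } : WorldP).C := by
    refine endStatementBPrinted_of_nodesP_alongRuns_partialSums { w with γ := γ₁, b := w.b, b_pos := w.b_pos } hγ₁ (M := M)
      (nodes_leavesP_reletter_of_le_all w hγ₁w w.b_pos hnodes)
      (fun P hsc => rgFlow_of_smallCouplings_of_isRecordOfRecord₁₃CSepCoPHS hRS' P hsc) (fun P hsc => ?_) (fun P hsc => ?_) hsmall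
    · have hrgP : (D.C.toB12 P).flow.SatisfiesRG P.K := by
        have h' := rgFlow_of_smallCouplings_of_isRecordOfRecord₁₃CSepCoPHS hRS' P hsc
        show (D.C P).flow.SatisfiesRG P.K
        rw [← hC]; exact h'
      have hsc' : (D.C.toB12 P).flow.InInterval γ₁ P.K := by
        show (D.C P).flow.InInterval γ₁ P.K
        rw [← hC]; exact hsc
      show ∀ j, j < P.K → (w.C P).flow.β (j + 1) ((w.C P).flow.g j) ≤ w.βup
      rw [hC]
      exact fun j hj => (upper_alongRun_of_runConstRemainder D.C.toB12 D.βfun D.curries hγ₁₀ hrem hB P hrgP hsc' j hj).trans hmatch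
    · have hrgP : (D.C.toB12 P).flow.SatisfiesRG P.K := by
        have h' := rgFlow_of_smallCouplings_of_isRecordOfRecord₁₃CSepCoPHS hRS' P hsc
        show (D.C P).flow.SatisfiesRG P.K
        rw [← hC]; exact h'
      have hsc' : (D.C.toB12 P).flow.InInterval γ₁ P.K := by
        show (D.C P).flow.InInterval γ₁ P.K
        rw [← hC]; exact hsc
      show ∀ m n, m ≤ n → n ≤ P.K → -M ≤ ∑ j ∈ Finset.Ico m n, (w.C P).flow.β (j + 1) ((w.C P).flow.g j)
      rw [hC]
      exact partialSums_alongRun_of_runwisePS D.C.toB12 D.βfun D.curries hγ₁₀ hps P hrgP hsc'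
  refine ⟨?_, window_of_frequently_beta_le D (frequently_betaZero_le_of_runConstRemainder hγ₀ hrem)⟩
  have : ({ w with γ := γ₁, b := w.b, b_pos := w.b_pos } : WorldP).C = D.C := hC
  rw [← this]
  exact hB

/-- **★ THE CRUX's CONSEQUENT AT θ FROM A RUNG-1 DATUM AND RUN LETTERS ONLY** (θ-keyed; plan's skeleton-local `RecordS F θ h w` spelled out, as in g0's files): unity ∧ slots, admissibility,
an S-bound world of the datum with the thirteen nodes at every run, and on SOME level `γ₀ > 0` the run letters of the D-keyed headline for `betaOfRecord₁₃ θ` (= the datum's `βfun`,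
`Node00.βfun_datumOfRecord₁₃SepCoPH`, `rfl`) ⊢ the body of `StabilityBAtRecordR13SepCoPH` AT θ.  CONDITIONAL; closes nothing.
[cite: Balaban1989LargeFieldII, Thm 1 p.355 + (0.1) pp.355–356 + p.391; Balaban1988Convergent, (2.6) p.255, Cor. 3 (2.50) p.264; Balaban1987RG1, (0.20) p.256, Thm 2 p.259, Thm 3 p.264 (bookkeeping)] -/
theorem stabilityB_body_of_rung1At_of_runLetters (θ : Stage13HParams F N) (h : θ.Provisos₁₃SepCoPH F N) (w : WorldP)
    (hU : θ.ZhUnity F N ∧ θ.SlotsNondegenerate₁₃ F N) (hθ : θ.Admissible F N)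
    (hR : ∃ (θ' : Stage13HParams F N) (h' : θ'.Provisos₁₃SepCoPH F N), θ'.Admissible F N ∧
      datumOfRecord₁₃SepCoPH F N θ h = datumOfRecord₁₃SepCoPH F N θ' h' ∧ w.C = (datumOfRecord₁₃SepCoPH F N θ h).C ∧ (0 < w.γ ∧ w.γ ≤ θ'.γ) ∧
      w.L = (θ'.L : ℝ) ∧ ∀ P : B12.RunParams, w.up P = upOfRecord₅CS F N (θ'.toStage5₁₃CoPH F N) P)
    (hnodes : ∀ P : B12.RunParams, Nodes (leavesP w P))
    {b : ℕ → ℝ} {r γ₀ B M : ℝ} (hγ₀ : 0 < γ₀) (hrem : RunConstRemainder (betaOfRecord₁₃ F N θ.toStage13Params) b r γ₀) (hB : ∀ k, b k ≤ B) (hmatch : B + r ≤ w.βup)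
    (hps : ∀ (n : ℕ) (gs : ℕ → ℝ), RGEqH n (betaOfRecord₁₃ F N θ.toStage13Params) gs → Step.InInterval γ₀ n gs →
      ∀ k, k ≤ n → -M ≤ ∑ j ∈ Finset.Ico k n, betaOfRecord₁₃ F N θ.toStage13Params j (prefixOf gs j)) :
    (θ.ZhUnity F N ∧ θ.SlotsNondegenerate₁₃ F N) ∧ θ.Admissible F N ∧ B16.EndStatementBPrinted (datumOfRecord₁₃SepCoPH F N θ h).C ∧
      ∃ γ₁ : ℝ, 0 < γ₁ ∧ ∀ γ : ℝ, 0 < γ → γ ≤ γ₁ → ∃ P : B12.RunParams, 1 ≤ P.K ∧ ((datumOfRecord₁₃SepCoPH F N θ h).C P).flow.InInterval γ P.K :=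
  ⟨hU, hθ, endStatementBPrinted_window_of_isRecordOfRecord₁₃CSepCoPHS_of_nodes_of_runLetters ((recordS₁₃SepCoPH_iff F N θ h w).1 hR) hnodes hγ₀ hrem hB hmatch hps⟩

end AtRecord

/-! ## §3. ★★ `N = 2`: the consequent AT θ from a rung-1 datum, DEF-1's RUN letter `RunRemAt F κ θ h c`, the bare drift, and the numeric ceiling match -/

section RunLetter

variable {F : T4Family}

/-- **★★ THE CRUX's CONSEQUENT AT θ FROM A RUNG-1 DATUM AND THE RUN EDITION AT θ.**  `hRun : RunRemAt F κ θ h c` (DEF-1's run letter VERBATIM: run-wise constant remainder with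
cap `s ≤ c·stepBal 2 F.L` on some level `γ₀ ≤ θ.γ`, box anchor, survivor continuity — the last two UNREAD here), `hdrift` = the bare drift of the named numbers for that κ (the 1ᴮ″∕1′
stubs' conclusion), `hmatch` = the ONE K1-side letter: the rung-1 world's ceiling clears `2c·stepBal 2 F.L + 2|c|A`.  Road: drift rescaled to `c • beta0OfJs F κ` ∕ slope `c·stepBal`
∕ defect `|c|·A` (`oneLoopDrift_const_mul`); band `c·b_k ≤ c·stepBal + 2|c|A` (`band_of_drift`); run-wise (PS) `−2|c|A` (DEF-1's `runwisePS_of_drift_runConstRemainder`, cap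
`s ≤ c·stepBal`); §2.  NO box ceiling, NO box floor, NO (C).  CONDITIONAL; (P6) unpinned; nothing of Bałaban asserted; K1⁷ ∕ K2⁷ NOT closed.
[cite: Balaban1987RG1, Thm 2 p.259, Thm 3 p.264, (1.20)–(1.22) p.264, (2.12)–(2.14) p.268, (5.10) p.293; Balaban1989LargeFieldII, Thm 1 p.355; Balaban1988Convergent, (2.6) p.255 (bookkeeping)] -/
theorem stabilityB_body_of_rung1At_of_runRemAt_of_drift (θ : Stage13HParams F 2) (h : θ.Provisos₁₃SepCoPH F 2) (w : WorldP)
    (hU : θ.ZhUnity F 2 ∧ θ.SlotsNondegenerate₁₃ F 2) (hθ : θ.Admissible F 2)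
    (hR : ∃ (θ' : Stage13HParams F 2) (h' : θ'.Provisos₁₃SepCoPH F 2), θ'.Admissible F 2 ∧
      datumOfRecord₁₃SepCoPH F 2 θ h = datumOfRecord₁₃SepCoPH F 2 θ' h' ∧ w.C = (datumOfRecord₁₃SepCoPH F 2 θ h).C ∧ (0 < w.γ ∧ w.γ ≤ θ'.γ) ∧
      w.L = (θ'.L : ℝ) ∧ ∀ P : B12.RunParams, w.up P = upOfRecord₅CS F 2 (θ'.toStage5₁₃CoPH F 2) P)
    (hnodes : ∀ P : B12.RunParams, Nodes (leavesP w P)) (κ : StepColourData) {c A : ℝ}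
    (hRun : RunRemAt F κ θ h c) (hdrift : OneLoopDrift (B12Normalization.stepBal 2 F.L) A (beta0OfJs F κ))
    (hmatch : 2 * (c * B12Normalization.stepBal 2 F.L) + 2 * (|c| * A) ≤ w.βup) :
    (θ.ZhUnity F 2 ∧ θ.SlotsNondegenerate₁₃ F 2) ∧ θ.Admissible F 2 ∧ B16.EndStatementBPrinted (datumOfRecord₁₃SepCoPH F 2 θ h).C ∧
      ∃ γ₁ : ℝ, 0 < γ₁ ∧ ∀ γ : ℝ, 0 < γ → γ ≤ γ₁ → ∃ P : B12.RunParams, 1 ≤ P.K ∧ ((datumOfRecord₁₃SepCoPH F 2 θ h).C P).flow.InInterval γ P.K := by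
  obtain ⟨γ₀, s, hγ₀, -, hcap, hrem, -, -⟩ := hRun
  have hd := oneLoopDrift_const_mul hdrift c
  have hband : ∀ k, c * beta0OfJs F κ k ≤ c * B12Normalization.stepBal 2 F.L + 2 * (|c| * A) := fun k => by
    have := (abs_le.mp (band_of_drift hd k)).2
    linarith
  have hmatch' : c * B12Normalization.stepBal 2 F.L + 2 * (|c| * A) + s ≤ w.βup := by linarith
  exact stabilityB_body_of_rung1At_of_runLetters θ h w hU hθ hR hnodes hγ₀ hrem hband hmatch' (runwisePS_of_drift_runConstRemainder hd hrem hcap)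

/-- **THE BOX LETTER ⟹ THE RUN LETTER ON THE K1 ROAD**: g0's E3 §1 (`K1EndOfNodes13PWSOfK2NamedJetsE3.stabilityB_body_of_rung1At_of_remAtE3_of_drift`) took ed.3's box letter
`RemAt F κ θ h c` AND a box-ceiling letter `BetaUpperH w.βup γ₁ β_θ`; through `runRemAt_of_remAt` the present road needs the box letter's RUN content only and trades the ceiling letter for
the numeric match. [cite: Balaban1987RG1, (1.20)–(1.22) p.264 and (2.12)–(2.14) p.268 (bookkeeping)] -/
theorem stabilityB_body_of_rung1At_of_remAt_of_drift_of_match (θ : Stage13HParams F 2) (h : θ.Provisos₁₃SepCoPH F 2) (w : WorldP)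
    (hU : θ.ZhUnity F 2 ∧ θ.SlotsNondegenerate₁₃ F 2) (hθ : θ.Admissible F 2)
    (hR : ∃ (θ' : Stage13HParams F 2) (h' : θ'.Provisos₁₃SepCoPH F 2), θ'.Admissible F 2 ∧
      datumOfRecord₁₃SepCoPH F 2 θ h = datumOfRecord₁₃SepCoPH F 2 θ' h' ∧ w.C = (datumOfRecord₁₃SepCoPH F 2 θ h).C ∧ (0 < w.γ ∧ w.γ ≤ θ'.γ) ∧
      w.L = (θ'.L : ℝ) ∧ ∀ P : B12.RunParams, w.up P = upOfRecord₅CS F 2 (θ'.toStage5₁₃CoPH F 2) P)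
    (hnodes : ∀ P : B12.RunParams, Nodes (leavesP w P)) (κ : StepColourData) {c A : ℝ}
    (hRem : RemAt F κ θ h c) (hdrift : OneLoopDrift (B12Normalization.stepBal 2 F.L) A (beta0OfJs F κ))
    (hmatch : 2 * (c * B12Normalization.stepBal 2 F.L) + 2 * (|c| * A) ≤ w.βup) :
    (θ.ZhUnity F 2 ∧ θ.SlotsNondegenerate₁₃ F 2) ∧ θ.Admissible F 2 ∧ B16.EndStatementBPrinted (datumOfRecord₁₃SepCoPH F 2 θ h).C ∧
      ∃ γ₁ : ℝ, 0 < γ₁ ∧ ∀ γ : ℝ, 0 < γ → γ ≤ γ₁ → ∃ P : B12.RunParams, 1 ≤ P.K ∧ ((datumOfRecord₁₃SepCoPH F 2 θ h).C P).flow.InInterval γ P.K :=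
  stabilityB_body_of_rung1At_of_runRemAt_of_drift θ h w hU hθ hR hnodes κ (runRemAt_of_remAt F κ θ h hRem) hdrift hmatch

end RunLetter

/-! ## §4. ★★★ The ROUTE DECL BY NAME: from ONE ∃-side producer «rung 1 WITH run rows at the witness», and from the REGISTERED stub-1 text + run rows at every witness -/

section Registered

/-- **★★★ K1⁷ BY NAME FROM ONE ∃-SIDE PRODUCER «RUNG 1 WITH RUN ROWS AT THE WITNESS»** — the post-№204 closing shape in the run currency.  `h` says: for every family `F` with a unity
Stage-13 tuple (K0⁷'s conclusion), SOME unity tuple `θ` with provisos `h` carries (i) at SOME scale `c` and for SOME colour datum `κ` the RUN rows `RunRemAt F κ θ h c` with the bare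
drift of the named numbers (defect `A`), and (ii) an S-bound world of its datum (plan's `RecordS`, spelled out) whose ceiling clears `2c·stepBal 2 F.L + 2|c|A` and all of whose runs'
leaf worlds satisfy the thirteen DAG nodes.  Conclusion: `Summit.QuantumFields.YangMills.Theses.BalabanUVNodes.StabilityBAtRecordR13SepCoPH` — the TYPE is the route decl literally.
So, after DECISION-204, K1⁷ = «rung 1 + the run rows, BOTH at the K0 witness, + one numeric match»; the K2⁷ v5 stubs (which assume (B)) are NOT read.  CONDITIONAL on `h` (not
supplied here); K1⁷ is NOT closed by this theorem; nothing of Bałaban asserted; no count moved.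
[cite: Balaban1989LargeFieldII, Thm 1 p.355 + (0.1) pp.355–356 + p.391; Balaban1987RG1, Thm 2 p.259, Thm 3 p.264, (1.20)–(1.22) p.264, (2.12)–(2.14) p.268, (5.10) p.293; Balaban1988Convergent, (2.6) p.255 and Cor. 3 (2.50) p.264 (bookkeeping)] -/
theorem stabilityBAtRecordR13SepCoPH_of_rung1WithRunRowsAt
    (h : ∀ F : T4Family, (∃ θ : Stage13HParams F 2, θ.Provisos₁₃SepCoPH F 2 ∧ (θ.ZhUnity F 2 ∧ θ.SlotsNondegenerate₁₃ F 2) ∧ θ.Admissible F 2) →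
      ∃ (θ : Stage13HParams F 2) (h : θ.Provisos₁₃SepCoPH F 2), (θ.ZhUnity F 2 ∧ θ.SlotsNondegenerate₁₃ F 2) ∧ θ.Admissible F 2 ∧
        ∃ (κ : StepColourData) (c A : ℝ), RunRemAt F κ θ h c ∧ OneLoopDrift (B12Normalization.stepBal 2 F.L) A (beta0OfJs F κ) ∧
          ∃ w : WorldP, 2 * (c * B12Normalization.stepBal 2 F.L) + 2 * (|c| * A) ≤ w.βup ∧
            (∃ (θ' : Stage13HParams F 2) (h' : θ'.Provisos₁₃SepCoPH F 2), θ'.Admissible F 2 ∧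
              datumOfRecord₁₃SepCoPH F 2 θ h = datumOfRecord₁₃SepCoPH F 2 θ' h' ∧ w.C = (datumOfRecord₁₃SepCoPH F 2 θ h).C ∧ (0 < w.γ ∧ w.γ ≤ θ'.γ) ∧
              w.L = (θ'.L : ℝ) ∧ ∀ P : B12.RunParams, w.up P = upOfRecord₅CS F 2 (θ'.toStage5₁₃CoPH F 2) P) ∧
            ∀ P : B12.RunParams, Nodes (leavesP w P)) :
    Summit.QuantumFields.YangMills.Theses.BalabanUVNodes.StabilityBAtRecordR13SepCoPH := by
  intro F hinh
  obtain ⟨θ, hP, hU, hθ, κ, c, A, hRun, hdrift, w, hmatch, hR, hnodes⟩ := h F hinh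
  exact ⟨θ, hP, stabilityB_body_of_rung1At_of_runRemAt_of_drift θ hP w hU hθ hR hnodes κ hRun hdrift hmatch⟩

/-- **★★★ THE SAME FROM THE REGISTERED STUB 1 TEXT PLUS «RUN ROWS + DRIFT + MATCH AT EVERY RUNG-1 WITNESS»**: `h₁` = K1⁷ v5's STUB 1 `∀ F, Inhabited13 F → NodesAtSomeRecord13PWS F`
(texts VERBATIM, `RecordS` unfolded); `hrows` = «at every rung-1 witness `(θ, h, w)`: for SOME `κ, c, A`, the run rows `RunRemAt F κ θ h c`, the bare drift with defect `A`, and the match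
`2c·stepBal 2 F.L + 2|c|A ≤ w.βup`» — an ALTERNATIVE kernel-checked composition beside plan's `StabilityBAtRecordR13SepCoPH_of stub_nodes13PWS stub_betaWindow13PWS` whose β-side input is
the RUN edition (two notches below rung 2's AF box, one below g0's partial-sum BOX).  CONDITIONAL on both hypotheses; K1⁷ NOT closed by this theorem; nothing of Bałaban asserted; no count moved.
**v1.1 LOCATED (K1NEGCTL, CRIT-1 p602267): `hrows` quantifies a ceiling letter `… ≤ w.βup` over ALL rung-1 witnesses and is therefore jointly INCONSISTENT with `h₁` on every inhabited family
(nodes antitone in `w.βup`) — VACUOUS-BY-ANTECEDENT; use the ∃-bundled `stabilityBAtRecordR13SepCoPH_of_rung1WithRunRowsAt` or K1 v6's `K1V6Defs.stabilityBAtRecordR13SepCoPH_of_stubTexts`.**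
[cite: Balaban1989LargeFieldII, Thm 1 p.355 + (0.1) pp.355–356 + p.391; Balaban1987RG1, Thm 2 p.259, Thm 3 p.264, (2.12)–(2.14) p.268, (5.10) p.293; Balaban1988Convergent, (2.6) p.255 and Cor. 3 (2.50) p.264 (bookkeeping)] -/
theorem stabilityBAtRecordR13SepCoPH_of_stub1_of_runRowsMatch_at_witness
    (h₁ : ∀ F : T4Family, (∃ θ : Stage13HParams F 2, θ.Provisos₁₃SepCoPH F 2 ∧ (θ.ZhUnity F 2 ∧ θ.SlotsNondegenerate₁₃ F 2) ∧ θ.Admissible F 2) →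
      ∃ (θ : Stage13HParams F 2) (h : θ.Provisos₁₃SepCoPH F 2) (w : WorldP), (θ.ZhUnity F 2 ∧ θ.SlotsNondegenerate₁₃ F 2) ∧ θ.Admissible F 2 ∧
        (∃ (θ' : Stage13HParams F 2) (h' : θ'.Provisos₁₃SepCoPH F 2), θ'.Admissible F 2 ∧
          datumOfRecord₁₃SepCoPH F 2 θ h = datumOfRecord₁₃SepCoPH F 2 θ' h' ∧ w.C = (datumOfRecord₁₃SepCoPH F 2 θ h).C ∧ (0 < w.γ ∧ w.γ ≤ θ'.γ) ∧
          w.L = (θ'.L : ℝ) ∧ ∀ P : B12.RunParams, w.up P = upOfRecord₅CS F 2 (θ'.toStage5₁₃CoPH F 2) P) ∧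
        (∀ P : B12.RunParams, Nodes (leavesP w P)) ∧ PrintedUV3V 2 θ.L ∧
        ∃ lam : ResidW F 2, (∀ P : B12.RunParams, 1 ≤ P.K → lam.kSel P < P.K) ∧
          ∀ P : B12.RunParams, lam.kSel P < P.K → ((leavesP w P).rBasicStep ↔ B15Leaf (WOfRecord₁₃ F 2 θ.toStage13Params lam P)))
    (hrows : ∀ (F : T4Family) (θ : Stage13HParams F 2) (h : θ.Provisos₁₃SepCoPH F 2) (w : WorldP),
      (θ.ZhUnity F 2 ∧ θ.SlotsNondegenerate₁₃ F 2) → θ.Admissible F 2 →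
      (∃ (θ' : Stage13HParams F 2) (h' : θ'.Provisos₁₃SepCoPH F 2), θ'.Admissible F 2 ∧
        datumOfRecord₁₃SepCoPH F 2 θ h = datumOfRecord₁₃SepCoPH F 2 θ' h' ∧ w.C = (datumOfRecord₁₃SepCoPH F 2 θ h).C ∧ (0 < w.γ ∧ w.γ ≤ θ'.γ) ∧
        w.L = (θ'.L : ℝ) ∧ ∀ P : B12.RunParams, w.up P = upOfRecord₅CS F 2 (θ'.toStage5₁₃CoPH F 2) P) →
      (∀ P : B12.RunParams, Nodes (leavesP w P)) →
      ∃ (κ : StepColourData) (c A : ℝ), RunRemAt F κ θ h c ∧ OneLoopDrift (B12Normalization.stepBal 2 F.L) A (beta0OfJs F κ) ∧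
        2 * (c * B12Normalization.stepBal 2 F.L) + 2 * (|c| * A) ≤ w.βup) :
    Summit.QuantumFields.YangMills.Theses.BalabanUVNodes.StabilityBAtRecordR13SepCoPH := by
  intro F hinh
  obtain ⟨θ, hP, w, hU, hθ, hR, hnodes, -, -⟩ := h₁ F hinh
  obtain ⟨κ, c, A, hRun, hdrift, hmatch⟩ := hrows F θ hP w hU hθ hR hnodes
  exact ⟨θ, hP, stabilityB_body_of_rung1At_of_runRemAt_of_drift θ hP w hU hθ hR hnodes κ hRun hdrift hmatch⟩

/-- **THE BOX-CURRENCY PRODUCER IS A SPECIAL CASE**: the same ∃-side producer with ed.3's BOX letter `RemAt F κ θ h c` (g0's E3 currency, p595293) in place of the run letter also gives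
the route decl BY NAME (`runRemAt_of_remAt`; §3) — so a K1 v6 cut may register EITHER currency at the witness; the run one is the weaker ask.  CONDITIONAL; K1⁷ NOT closed by this theorem.
[cite: Balaban1989LargeFieldII, Thm 1 p.355 + (0.1) pp.355–356; Balaban1987RG1, Thm 2 p.259, (1.20)–(1.22) p.264, (2.12)–(2.14) p.268 (bookkeeping)] -/
theorem stabilityBAtRecordR13SepCoPH_of_rung1WithBoxRowsAt
    (h : ∀ F : T4Family, (∃ θ : Stage13HParams F 2, θ.Provisos₁₃SepCoPH F 2 ∧ (θ.ZhUnity F 2 ∧ θ.SlotsNondegenerate₁₃ F 2) ∧ θ.Admissible F 2) →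
      ∃ (θ : Stage13HParams F 2) (h : θ.Provisos₁₃SepCoPH F 2), (θ.ZhUnity F 2 ∧ θ.SlotsNondegenerate₁₃ F 2) ∧ θ.Admissible F 2 ∧
        ∃ (κ : StepColourData) (c A : ℝ), RemAt F κ θ h c ∧ OneLoopDrift (B12Normalization.stepBal 2 F.L) A (beta0OfJs F κ) ∧
          ∃ w : WorldP, 2 * (c * B12Normalization.stepBal 2 F.L) + 2 * (|c| * A) ≤ w.βup ∧
            (∃ (θ' : Stage13HParams F 2) (h' : θ'.Provisos₁₃SepCoPH F 2), θ'.Admissible F 2 ∧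
              datumOfRecord₁₃SepCoPH F 2 θ h = datumOfRecord₁₃SepCoPH F 2 θ' h' ∧ w.C = (datumOfRecord₁₃SepCoPH F 2 θ h).C ∧ (0 < w.γ ∧ w.γ ≤ θ'.γ) ∧
              w.L = (θ'.L : ℝ) ∧ ∀ P : B12.RunParams, w.up P = upOfRecord₅CS F 2 (θ'.toStage5₁₃CoPH F 2) P) ∧
            ∀ P : B12.RunParams, Nodes (leavesP w P)) :
    Summit.QuantumFields.YangMills.Theses.BalabanUVNodes.StabilityBAtRecordR13SepCoPH := by
  intro F hinh
  obtain ⟨θ, hP, hU, hθ, κ, c, A, hRem, hdrift, w, hmatch, hR, hnodes⟩ := h F hinh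
  exact ⟨θ, hP, stabilityB_body_of_rung1At_of_remAt_of_drift_of_match θ hP w hU hθ hR hnodes κ hRem hdrift hmatch⟩

end Registered

end Summit.QuantumFields.YangMills.BalabanUVNodes.K1EndOfNodes13PWSOfRunRemAt

end
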